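import Summits.Ventures.CertifiedArithmetic.LowPrec.DoubleRoundingProductSameQuantum
import Summits.Ventures.CertifiedArithmetic.LowPrec.DoubleRoundingProductWindowConverse

/-!
# Double rounding at equal quanta: a slip forces the midpoint window (pointwise converse)

HONEST FRAMING (venture CertifiedArithmetic / cell `pub-lowprec`): certified error envelopes and
provably optimal rounding/accumulation schemes for low-precision formats under stated cost models;
every table by two implementations; no hardware or vendor claims.

ONE GRID INSIDE ANOTHER, the binades.  `φ` and `ψ` have the SAME quantum `q` (`L_ψ = L_φ`,
`d = 0`), `m = m_φ ≥ 1`, `m_ψ ≥ 1`.  In the binade where `φ` has spacing `2^w q` (`w ≥ 1`) take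
`x = (c·2^(w+u) + r)·q/2^u`, `u ≥ 1`, `r < 2^(w+u)`, `2^m ≤ c < 2^(m+1)` (the cell
`[c, c+1]·2^w q` of `φ`), with `(c+1)·2^w` in range of both formats and below `2^(m_ψ+1)` (so the
register holds EVERY multiple of `q` on the cell).  THEOREM (`sameQ_window_of_roundNE_roundNE_ne`):
a slip `fl_φ (fl_ψ x) ≠ fl_φ x` forces, with `n = w + u - 1`,
`(c even ∧ 2^n < r ∧ (r < 2^n + 2^(u-1) ∨ (w ≥ 2 ∧ r = 2^n + 2^(u-1)))) ∨
 (c odd ∧ r < 2^n ∧ (2^n - 2^(u-1) < r ∨ (w ≥ 2 ∧ r = 2^n - 2^(u-1))))`.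
Proof: `fl_ψ x`, the nearest multiple of `q` (within `q/2 = 2^(u-1)·q/2^u`), stays on the side of
the midpoint `μ = (2c+1)·2^(w-1) q` where `fl_φ` is constant (projection at the corners, the gap
lemmas `toRat_roundNE_below_gmid` / `above_gmid` inside) unless it IS `μ`; then `fl_φ μ` is the
even corner (`toRat_roundNE_gmid` / `gmid_odd`), a slip iff `c` has the odd-side parity; and at
distance exactly `q/2` (a tie of `ψ`, `u = 1`) ties-to-even in `ψ` makes the multiple
`(2c+1)·2^(w-1)` of `μ` even (`roundNE_man_even_of_tie`, `two_dvd_man_iff`), i.e. `w ≥ 2`.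
This is the pointwise converse behind the decision `DoubleRoundingProductSameQuantumLaw.lean`
(the `d ≥ 1` analogue is `window_of_roundNE_roundNE_ne`, whose inclusive boundary is WRONG at
`d = 0`, `w = 1`: e.g. `P = 3`, `x = 21 q/2` does not slip).
Two implementations: A = `code/enum/mul_sameq_decision.py` (hit set of the window = brute-force
slip set of the exact-rational model, `P ≤ 9`) → `certs/enum/DOUBLE-ROUNDING-MUL-SAMEQ-LAW.json`;
B = this file (structural, every record).
PLACEMENT — KNOWN: a double-rounding slip forces the intermediate result onto a midpoint of the
target ([MartinDorelMelquiondMuller2013] Property 2.1; [BoldoMelquiond2008] Thm 3;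
[Figueroa1995] §2–3).  NEW (modestly): the record-generic window at `d = 0` with the refined tie
boundary.  No hardware or vendor claims.
-/

namespace Summit.Ventures.CertifiedArithmetic

open Literature.ComputerArithmetic.FloatingPoint
open Literature.ComputerArithmetic.FloatingPoint.Format
open Literature.ComputerArithmetic.FloatingPoint.MiniFloat

/-! ## §1 A slip forces the window -/

/-- A SLIP FORCES THE WINDOW (equal quanta; the converse of the midpoint mechanism, pointwise):
`L_ψ = L_φ`, `m_φ, m_ψ ≥ 1`; for `x = (c·2^(w+u) + r)·q/2^u` with `u, w ≥ 1`, `r < 2^(w+u)`,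
`2^m ≤ c < 2^(m+1)` (the cell `[c, c+1]·2^w q` of `φ`, spacing `2^w q`), `(c+1)·2^w` in range of
both and below `2^(m_ψ+1)` (the register holds every multiple of `q` there), a slip
`fl_φ (fl_ψ x) ≠ fl_φ x` forces, with `n = w + u - 1`,
`(c even ∧ 2^n < r ∧ (r < 2^n + 2^(u-1) ∨ (w ≥ 2 ∧ r = 2^n + 2^(u-1)))) ∨
 (c odd ∧ r < 2^n ∧ (2^n - 2^(u-1) < r ∨ (w ≥ 2 ∧ r = 2^n - 2^(u-1))))`:
`fl_ψ x` stays on the side of the midpoint `μ = (2c+1)·2^(w-1) q` where `fl_φ` is constant unless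
it IS `μ` (`x` within `q/2` of it), crossed iff `c` has the odd-side parity; at distance exactly
`q/2` (a tie of `ψ`) with `w = 1` the multiple `(2c+1)` of `μ` is odd and ties-to-even in `ψ`
avoids `μ`. [this packet; cite: MartinDorelMelquiondMuller2013, Property 2.1] -/
theorem sameQ_window_of_roundNE_roundNE_ne {φ ψ : Format} (hq : ψ.qexp = φ.qexp)
    (h1 : 1 ≤ φ.manBits) (h1ψ : 1 ≤ ψ.manBits) {c r u w : ℕ} (hu : 1 ≤ u) (hw : 1 ≤ w)
    (hr : r < 2 ^ (w + u)) (hclo : 2 ^ φ.manBits ≤ c) (hchi : c < 2 ^ (φ.manBits + 1))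
    (hcM : (c + 1) * 2 ^ w ≤ φ.maxScaled) (hψm : (c + 1) * 2 ^ w < 2 ^ (ψ.manBits + 1))
    (hψM : (c + 1) * 2 ^ w ≤ ψ.maxScaled)
    (hne : (roundNE φ (roundNE ψ (((c * 2 ^ (w + u) + r : ℕ) : ℚ)
        * φ.quantum / 2 ^ u)).toRat).toRat
      ≠ (roundNE φ (((c * 2 ^ (w + u) + r : ℕ) : ℚ) * φ.quantum / 2 ^ u)).toRat) :
    (c % 2 = 0 ∧ 2 ^ (w + u - 1) < r ∧
        (r < 2 ^ (w + u - 1) + 2 ^ (u - 1) ∨ (2 ≤ w ∧ r = 2 ^ (w + u - 1) + 2 ^ (u - 1)))) ∨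
      (c % 2 = 1 ∧ r < 2 ^ (w + u - 1) ∧
        (2 ^ (w + u - 1) < r + 2 ^ (u - 1) ∨ (2 ≤ w ∧ r + 2 ^ (u - 1) = 2 ^ (w + u - 1)))) := by
  have hq0 := φ.quantum_pos
  have hQ : ψ.quantum = φ.quantum := by
    show (2 : ℚ) ^ ψ.qexp = (2 : ℚ) ^ φ.qexp
    rw [hq]
  obtain ⟨k, rfl⟩ : ∃ k, w = k + 1 := ⟨w - 1, by omega⟩
  rw [show k + 1 + u - 1 = k + u by omega]
  rw [show k + 1 + u = k + u + 1 by omega] at hr hne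
  -- the unit `s = q / 2^u`
  set s : ℚ := φ.quantum / 2 ^ u with hs
  have hs0 : 0 < s := by positivity
  have hq' : φ.quantum = 2 ^ u * s := by rw [hs]; field_simp
  have hu2 : (2 : ℚ) ^ u = 2 * 2 ^ (u - 1) := by rw [← pow_succ']; congr 1; omega
  have hku : (2 : ℚ) ^ (k + u) = 2 ^ k * 2 ^ u := pow_add _ _ _
  have h2k : 2 ^ (k + 1) = 2 * 2 ^ k := pow_succ' 2 k
  set x : ℚ := ((c * 2 ^ (k + u + 1) + r : ℕ) : ℚ) * φ.quantum / 2 ^ u with hx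
  -- `V = c·2^(k+1) q` (low corner), `μ = V + 2^(k+u) s` (midpoint), `V' = V + 2·2^(k+u) s`
  have hV : ((c * 2 ^ (k + 1) : ℕ) : ℚ) * φ.quantum = (c : ℚ) * 2 ^ (k + 1) * 2 ^ u * s := by
    push_cast; rw [hq']; ring
  have hμ : (((2 * c + 1) * 2 ^ k : ℕ) : ℚ) * φ.quantum
      = (c : ℚ) * 2 ^ (k + 1) * 2 ^ u * s + 2 ^ (k + u) * s := by
    push_cast; rw [hq', hku]; ring
  have hV' : (((c + 1) * 2 ^ (k + 1) : ℕ) : ℚ) * φ.quantum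
      = (c : ℚ) * 2 ^ (k + 1) * 2 ^ u * s + 2 * (2 ^ (k + u) * s) := by
    push_cast; rw [hq', hku]; ring
  have hxs : x = (c : ℚ) * 2 ^ (k + 1) * 2 ^ u * s + (r : ℚ) * s := by
    rw [hx, hs]; push_cast; field_simp; ring
  have hrs0 : 0 ≤ (r : ℚ) * s := by positivity
  have hr2 : (r : ℚ) < 2 * 2 ^ (k + u) := by
    have : (r : ℚ) < 2 ^ (k + u + 1) := by exact_mod_cast hr
    rw [pow_succ] at this; linarith
  have hrs2 : (r : ℚ) * s < 2 * (2 ^ (k + u) * s) := by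
    have := mul_lt_mul_of_pos_right hr2 hs0; linarith
  -- the values in play
  obtain ⟨hrV, hrV'⟩ := representable_gmid (φ := φ) (t := c) (k := k) hchi hcM
  obtain ⟨vV, hvV⟩ := exists_toRat_eq_natMul hrV
  obtain ⟨vV', hvV'⟩ := exists_toRat_eq_natMul hrV'
  have hle1 : c * 2 ^ (k + 1) ≤ (c + 1) * 2 ^ (k + 1) := Nat.mul_le_mul_right _ (Nat.le_succ c)
  have hle2 : (2 * c + 1) * 2 ^ k ≤ (c + 1) * 2 ^ (k + 1) := by
    rw [h2k, show (c + 1) * (2 * 2 ^ k) = (2 * c + 2) * 2 ^ k by ring]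
    exact Nat.mul_le_mul_right _ (by omega)
  obtain ⟨zV, hzV⟩ := exists_toRat_eq_natMul
    (representable_of_lt_pow (φ := ψ) (lt_of_le_of_lt hle1 hψm) (le_trans hle1 hψM))
  obtain ⟨zμ, hzμ⟩ := exists_toRat_eq_natMul
    (representable_of_lt_pow (φ := ψ) (lt_of_le_of_lt hle2 hψm) (le_trans hle2 hψM))
  obtain ⟨zV', hzV'⟩ := exists_toRat_eq_natMul (representable_of_lt_pow (φ := ψ) hψm hψM)
  rw [hQ] at hzV hzμ hzV'
  -- `fl_ψ x` is within `q/2 = 2^(u-1) s` of `x`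
  have hdist : |x - (roundNE ψ x).toRat| ≤ 2 ^ (u - 1) * s := by
    obtain ⟨kk, hk⟩ : ∃ kk, r / 2 ^ u = kk := ⟨_, rfl⟩
    obtain ⟨ρ, hρ'⟩ : ∃ ρ, r % 2 ^ u = ρ := ⟨_, rfl⟩
    have hρ : r = kk * 2 ^ u + ρ := by rw [← hk, ← hρ']; exact (Nat.div_add_mod' r (2 ^ u)).symm
    have hρlt : ρ < 2 ^ u := by rw [← hρ']; exact Nat.mod_lt _ (by positivity)
    have hk1 : kk < 2 ^ (k + 1) := by
      rw [← hk, Nat.div_lt_iff_lt_mul (by positivity), ← pow_add,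
        show k + 1 + u = k + u + 1 by omega]
      exact hr
    have hk2 : (c + 1) * 2 ^ (k + 1) = c * 2 ^ (k + 1) + 2 ^ (k + 1) := by ring
    have hρq : (r : ℚ) = (kk : ℚ) * 2 ^ u + ρ := by exact_mod_cast hρ
    rcases le_or_gt (ρ * 2) (2 ^ u) with hlo | hhi
    · obtain ⟨z, hz⟩ := exists_toRat_eq_natMul (representable_of_lt_pow (φ := ψ)
        (n := c * 2 ^ (k + 1) + kk) (by omega) (by omega))
      refine le_trans (roundNE_nearest (φ := ψ) x z) ?_
      have e : x - z.toRat = (ρ : ℚ) * s := by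
        rw [hxs, hz, hQ, hρq, hq']; push_cast; ring
      have : (ρ : ℚ) * 2 ≤ 2 ^ u := by exact_mod_cast hlo
      rw [e, abs_of_nonneg (by positivity)]; rw [hu2] at this
      exact mul_le_mul_of_nonneg_right (by linarith) hs0.le
    · obtain ⟨z, hz⟩ := exists_toRat_eq_natMul (representable_of_lt_pow (φ := ψ)
        (n := c * 2 ^ (k + 1) + kk + 1) (by omega) (by omega))
      refine le_trans (roundNE_nearest (φ := ψ) x z) ?_
      have e : x - z.toRat = -(((2 ^ u - ρ : ℕ) : ℚ) * s) := by
        rw [hxs, hz, hQ, hρq, hq', Nat.cast_sub hρlt.le]; push_cast; ring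
      have : (((2 ^ u - ρ : ℕ)) : ℚ) * 2 ≤ 2 ^ u := by
        exact_mod_cast (by omega : (2 ^ u - ρ) * 2 ≤ 2 ^ u)
      rw [e, abs_neg, abs_of_nonneg (by positivity)]; rw [hu2] at this
      exact mul_le_mul_of_nonneg_right (by linarith) hs0.le
  -- `fl_φ` is constant on each half-cell (projection at the corners, the gap around `μ` inside)
  have hflV : (roundNE φ (((c * 2 ^ (k + 1) : ℕ) : ℚ) * φ.quantum)).toRat
      = ((c * 2 ^ (k + 1) : ℕ) : ℚ) * φ.quantum := by rw [← hvV, toRat_roundNE_toRat]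
  have hflV' : (roundNE φ ((((c + 1) * 2 ^ (k + 1) : ℕ) : ℚ) * φ.quantum)).toRat
      = (((c + 1) * 2 ^ (k + 1) : ℕ) : ℚ) * φ.quantum := by rw [← hvV', toRat_roundNE_toRat]
  have hlow : ∀ y : ℚ, (c : ℚ) * 2 ^ (k + 1) * 2 ^ u * s ≤ y →
      y < (c : ℚ) * 2 ^ (k + 1) * 2 ^ u * s + 2 ^ (k + u) * s →
      (roundNE φ y).toRat = ((c * 2 ^ (k + 1) : ℕ) : ℚ) * φ.quantum := by
    intro y hy1 hy2
    rcases eq_or_lt_of_le hy1 with hy | hy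
    · rw [← hy, ← hV]; exact hflV
    · have hδ0 : 0 < (((2 * c + 1) * 2 ^ k : ℕ) : ℚ) * φ.quantum - y := by rw [hμ]; linarith
      have hδ : (((2 * c + 1) * 2 ^ k : ℕ) : ℚ) * φ.quantum - y < 2 ^ k * φ.quantum := by
        have e2 : (2 : ℚ) ^ k * φ.quantum = 2 ^ (k + u) * s := by rw [hq', hku]; ring
        rw [e2, hμ]; linarith
      have e : y = (((2 * c + 1) * 2 ^ k : ℕ) : ℚ) * φ.quantum
          - ((((2 * c + 1) * 2 ^ k : ℕ) : ℚ) * φ.quantum - y) := by ring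
      rw [e]; exact toRat_roundNE_below_gmid hclo hchi hcM hδ0 hδ
  have hhigh : ∀ y : ℚ, (c : ℚ) * 2 ^ (k + 1) * 2 ^ u * s + 2 ^ (k + u) * s < y →
      y ≤ (c : ℚ) * 2 ^ (k + 1) * 2 ^ u * s + 2 * (2 ^ (k + u) * s) →
      (roundNE φ y).toRat = (((c + 1) * 2 ^ (k + 1) : ℕ) : ℚ) * φ.quantum := by
    intro y hy1 hy2
    rcases eq_or_lt_of_le hy2 with hy | hy
    · rw [hy, ← hV']; exact hflV'
    · have hδ0 : 0 < y - (((2 * c + 1) * 2 ^ k : ℕ) : ℚ) * φ.quantum := by rw [hμ]; linarith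
      have hδ : y - (((2 * c + 1) * 2 ^ k : ℕ) : ℚ) * φ.quantum < 2 ^ k * φ.quantum := by
        have e2 : (2 : ℚ) ^ k * φ.quantum = 2 ^ (k + u) * s := by rw [hq', hku]; ring
        rw [e2, hμ]; linarith
      have e : y = (((2 * c + 1) * 2 ^ k : ℕ) : ℚ) * φ.quantum
          + (y - (((2 * c + 1) * 2 ^ k : ℕ) : ℚ) * φ.quantum) := by ring
      rw [e]; exact toRat_roundNE_above_gmid hclo hchi hcM hδ0 hδ
  -- case analysis on the position of `x` in its cell
  rcases lt_trichotomy r (2 ^ (k + u)) with hrn | hrn | hrn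
  · -- below the midpoint: `fl_φ x = V`, `fl_ψ x ∈ [V, μ]`
    right
    have hrns : (r : ℚ) * s < 2 ^ (k + u) * s :=
      mul_lt_mul_of_pos_right (by exact_mod_cast hrn) hs0
    have hx1 : (c : ℚ) * 2 ^ (k + 1) * 2 ^ u * s ≤ x := by rw [hxs]; linarith
    have hx2 : x < (c : ℚ) * 2 ^ (k + 1) * 2 ^ u * s + 2 ^ (k + u) * s := by rw [hxs]; linarith
    have hfx : (roundNE φ x).toRat = ((c * 2 ^ (k + 1) : ℕ) : ℚ) * φ.quantum := hlow x hx1 hx2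
    have hy1 : (c : ℚ) * 2 ^ (k + 1) * 2 ^ u * s ≤ (roundNE ψ x).toRat := by
      have := toRat_roundNE_mono (φ := ψ) hx1
      rwa [← hV, ← hzV, toRat_roundNE_toRat, hzV, hV] at this
    have hy2 : (roundNE ψ x).toRat ≤ (c : ℚ) * 2 ^ (k + 1) * 2 ^ u * s + 2 ^ (k + u) * s := by
      have := toRat_roundNE_mono (φ := ψ) hx2.le
      rwa [← hμ, ← hzμ, toRat_roundNE_toRat, hzμ, hμ] at this
    rcases lt_or_eq_of_le hy2 with hlt | heq
    · exact absurd ((hlow _ hy1 hlt).trans hfx.symm) hne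
    · -- `fl_ψ x = μ`: distance, parity of `c`, and the refined boundary
      have hd2 : ((2 : ℚ) ^ (k + u) - r) * s ≤ 2 ^ (u - 1) * s := by
        have := hdist
        rwa [heq, hxs, show (c : ℚ) * 2 ^ (k + 1) * 2 ^ u * s + (r : ℚ) * s
          - ((c : ℚ) * 2 ^ (k + 1) * 2 ^ u * s + 2 ^ (k + u) * s) = -((2 ^ (k + u) - r) * s)
          by ring, abs_neg,
          abs_of_nonneg (mul_nonneg (sub_nonneg.2 (by exact_mod_cast hrn.le)) hs0.le)] at this
      have hd3 : (2 : ℚ) ^ (k + u) - r ≤ 2 ^ (u - 1) := le_of_mul_le_mul_right hd2 hs0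
      have hd2' : 2 ^ (k + u) ≤ r + 2 ^ (u - 1) := by
        have h' : ((2 ^ (k + u) : ℕ) : ℚ) ≤ ((r + 2 ^ (u - 1) : ℕ) : ℚ) := by push_cast; linarith
        exact_mod_cast h'
      have hcodd : c % 2 = 1 := by
        by_contra hc
        have := toRat_roundNE_gmid (k := k) h1 (Nat.even_iff.mpr (by omega)) hclo hchi hcM
        rw [hμ, ← heq] at this
        exact hne (this.trans hfx.symm)
      refine ⟨hcodd, hrn, ?_⟩
      rcases lt_or_eq_of_le hd2' with hlt' | heq'
      · exact Or.inl hlt'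
      · refine Or.inr ⟨?_, heq'.symm⟩
        -- `x` is a tie of `ψ` between `μ - q` and `μ`: ties-to-even makes `(2c+1)·2^k` even
        have hNpos : 1 ≤ (2 * c + 1) * 2 ^ k := Nat.one_le_iff_ne_zero.mpr (by positivity)
        obtain ⟨zlo, hzlo⟩ := exists_toRat_eq_natMul (representable_of_lt_pow (φ := ψ)
          (n := (2 * c + 1) * 2 ^ k - 1) (by omega) (by omega))
        rw [hQ] at hzlo
        have hr' : (r : ℚ) = 2 ^ (k + u) - 2 ^ (u - 1) := by
          have e1 : ((2 ^ (k + u) : ℕ) : ℚ) = ((r + 2 ^ (u - 1) : ℕ) : ℚ) := by rw [heq']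
          push_cast at e1; linarith
        have hzlo' : zlo.toRat
            = (c : ℚ) * 2 ^ (k + 1) * 2 ^ u * s + 2 ^ (k + u) * s - 2 ^ u * s := by
          rw [hzlo, Nat.cast_sub hNpos, sub_mul, hμ, hq']; push_cast; ring
        have hxlo : x - zlo.toRat = 2 ^ (u - 1) * s := by rw [hzlo', hxs, hr', hu2]; ring
        have hxμ : x - (roundNE ψ x).toRat = -(2 ^ (u - 1) * s) := by rw [heq, hxs, hr']; ring
        have htie : |x - zlo.toRat| = |x - (roundNE ψ x).toRat| := by rw [hxlo, hxμ, abs_neg]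
        have hne2 : zlo.toRat ≠ (roundNE ψ x).toRat := by
          rw [hzlo', heq]
          have : (0 : ℚ) < 2 ^ u * s := by positivity
          linarith
        have hev := roundNE_man_even_of_tie h1ψ htie hne2
        have heqψ : (roundNE ψ x).toRat = (((2 * c + 1) * 2 ^ k : ℕ) : ℚ) * ψ.quantum := by
          rw [hQ, hμ]; exact heq
        rw [two_dvd_man_iff h1ψ, scaledMag_eq_of_toRat_eq heqψ] at hev
        have h2 : 2 ∣ (2 * c + 1) * 2 ^ k := dvd_trans (Dvd.intro _ rfl) hev
        by_contra hk0
        rw [show k = 0 by omega, pow_zero, mul_one] at h2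
        omega
  · -- `x` is the midpoint itself, a value of `ψ`: no slip
    exact absurd (toRat_roundNE_roundNE_of_exists
      ⟨zμ, by rw [hzμ, hμ, hxs, hrn]; push_cast; ring⟩) hne
  · -- above the midpoint: `fl_φ x = V'`, `fl_ψ x ∈ [μ, V']`
    left
    have hrns : (2 : ℚ) ^ (k + u) * s < (r : ℚ) * s :=
      mul_lt_mul_of_pos_right (by exact_mod_cast hrn) hs0
    have hx1 : (c : ℚ) * 2 ^ (k + 1) * 2 ^ u * s + 2 ^ (k + u) * s < x := by rw [hxs]; linarith
    have hx2 : x ≤ (c : ℚ) * 2 ^ (k + 1) * 2 ^ u * s + 2 * (2 ^ (k + u) * s) := by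
      rw [hxs]; linarith
    have hfx : (roundNE φ x).toRat = (((c + 1) * 2 ^ (k + 1) : ℕ) : ℚ) * φ.quantum :=
      hhigh x hx1 hx2
    have hy1 : (c : ℚ) * 2 ^ (k + 1) * 2 ^ u * s + 2 ^ (k + u) * s ≤ (roundNE ψ x).toRat := by
      have := toRat_roundNE_mono (φ := ψ) hx1.le
      rwa [← hμ, ← hzμ, toRat_roundNE_toRat, hzμ, hμ] at this
    have hy2 : (roundNE ψ x).toRat
        ≤ (c : ℚ) * 2 ^ (k + 1) * 2 ^ u * s + 2 * (2 ^ (k + u) * s) := by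
      have := toRat_roundNE_mono (φ := ψ) hx2
      rwa [← hV', ← hzV', toRat_roundNE_toRat, hzV', hV'] at this
    rcases lt_or_eq_of_le hy1 with hlt | heq
    · exact absurd ((hhigh _ hlt hy2).trans hfx.symm) hne
    · have hd2 : ((r : ℚ) - 2 ^ (k + u)) * s ≤ 2 ^ (u - 1) * s := by
        have := hdist
        rwa [← heq, hxs, show (c : ℚ) * 2 ^ (k + 1) * 2 ^ u * s + (r : ℚ) * s
          - ((c : ℚ) * 2 ^ (k + 1) * 2 ^ u * s + 2 ^ (k + u) * s) = (r - 2 ^ (k + u)) * s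
          by ring, abs_of_nonneg (mul_nonneg (sub_nonneg.2 (by exact_mod_cast hrn.le)) hs0.le)]
          at this
      have hd3 : (r : ℚ) - 2 ^ (k + u) ≤ 2 ^ (u - 1) := le_of_mul_le_mul_right hd2 hs0
      have hd2' : r ≤ 2 ^ (k + u) + 2 ^ (u - 1) := by
        have h' : (r : ℚ) ≤ ((2 ^ (k + u) + 2 ^ (u - 1) : ℕ) : ℚ) := by push_cast; linarith
        exact_mod_cast h'
      have hceven : c % 2 = 0 := by
        by_contra hc
        have := toRat_roundNE_gmid_odd (k := k) h1 (Nat.odd_iff.mpr (by omega)) hclo hchi hcM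
        rw [hμ, heq] at this
        exact hne (this.trans hfx.symm)
      refine ⟨hceven, hrn, ?_⟩
      rcases lt_or_eq_of_le hd2' with hlt' | heq'
      · exact Or.inl hlt'
      · refine Or.inr ⟨?_, heq'⟩
        -- `x` is a tie of `ψ` between `μ` and `μ + q`: ties-to-even makes `(2c+1)·2^k` even
        have hle3 : (2 * c + 1) * 2 ^ k + 1 ≤ (c + 1) * 2 ^ (k + 1) := by
          rw [h2k, show (c + 1) * (2 * 2 ^ k) = (2 * c + 1) * 2 ^ k + 2 ^ k by ring]
          have : 1 ≤ 2 ^ k := Nat.one_le_two_pow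
          omega
        obtain ⟨zhi, hzhi⟩ := exists_toRat_eq_natMul (representable_of_lt_pow (φ := ψ)
          (n := (2 * c + 1) * 2 ^ k + 1) (lt_of_le_of_lt hle3 hψm) (le_trans hle3 hψM))
        rw [hQ] at hzhi
        have hr' : (r : ℚ) = 2 ^ (k + u) + 2 ^ (u - 1) := by exact_mod_cast heq'
        have hzhi' : zhi.toRat
            = (c : ℚ) * 2 ^ (k + 1) * 2 ^ u * s + 2 ^ (k + u) * s + 2 ^ u * s := by
          rw [hzhi, Nat.cast_add, add_mul, hμ, hq']; push_cast; ring
        have hxhi : x - zhi.toRat = -(2 ^ (u - 1) * s) := by rw [hzhi', hxs, hr', hu2]; ring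
        have hxμ : x - (roundNE ψ x).toRat = 2 ^ (u - 1) * s := by rw [← heq, hxs, hr']; ring
        have htie : |x - zhi.toRat| = |x - (roundNE ψ x).toRat| := by rw [hxhi, hxμ, abs_neg]
        have hne2 : zhi.toRat ≠ (roundNE ψ x).toRat := by
          rw [hzhi', ← heq]
          have : (0 : ℚ) < 2 ^ u * s := by positivity
          linarith
        have hev := roundNE_man_even_of_tie h1ψ htie hne2
        have heqψ : (roundNE ψ x).toRat = (((2 * c + 1) * 2 ^ k : ℕ) : ℚ) * ψ.quantum := by
          rw [hQ, hμ]; exact heq.symm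
        rw [two_dvd_man_iff h1ψ, scaledMag_eq_of_toRat_eq heqψ] at hev
        have h2 : 2 ∣ (2 * c + 1) * 2 ^ k := dvd_trans (Dvd.intro _ rfl) hev
        by_contra hk0
        rw [show k = 0 by omega, pow_zero, mul_one] at h2
        omega

end Summit.Ventures.CertifiedArithmetic
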